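import Summits.AtomisticToContinuum.HydrodynamicLimit.Theses.InformationPercolationEngine

/-!
# Assembly of route InformationPercolationEngine, rev 8/9 (stmt-AtomisticToContinuum-15140)

The assembly item of route `route-AtomisticToContinuum-InformationPercolationEngine` (rev 8/9) is the curried
implication

`KickFairRelEquilibrium → SpectralContractionR → PercolationClosesChaos → CollisionRate → LocalSecondLaw →
ChaosClosesEuler → DiluteSelfConsistency → HydrodynamicLimit`,

which is, arrow for arrow, the type of the route file's certified crux-only deciding theorem
`Summit.AtomisticToContinuum.HydrodynamicLimit.Theses.InformationPercolationEngine.closes`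
(`PercolationClosesChaos` applied to `KickFairRelEquilibrium` and `SpectralContractionR` gives `ContactChaos`; the
kinetic dock `ChaosClosesEuler` fed with `ContactChaos`, `CollisionRate`, `LocalSecondLaw` gives a packing guard `η₀ > 0`
and the guarded conjunct; `DiluteSelfConsistency` at `η := η₀` discharges the guard profile by profile with
`σ₀ := min σ₁ σ₂`). The proof is pure bookkeeping: unfold `Assembly`, introduce the seven cruxes, apply `closes`.

This supersedes, for the rev-8/9 item, the rev-3 file `InformationPercolationEngineAssembly.lean`
(`Theorems.Assembly_proof`, stmt-AtomisticToContinuum-13918, nine hypotheses incl. the dropped `KineticClosure`).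
prover-pitem-stmt-AtomisticToContinuum-15140-0.

**Repair 2026-08-17 (fullbuild breakage "34:26: introN failed").** The closing theorem was stated as
`theorem informationPercolationEngine_assembly_rev8_proof : InformationPercolationEngine.Assembly` and so tracked the
route's decl `Assembly`, which the planners restate UNDER THE SAME NAME at every revision. It proved the rev-8/9 reading
(stmt-AtomisticToContinuum-15140, closed `proved` by it @ 0c2bc2a375dc) and, unchanged, the rev-12 reading
(stmt-AtomisticToContinuum-15179, crux 2 renamed `KickFairRelEquilibriumMeso`; also credited to it), both
seven-antecedent chains identical to the type of `closes`. Rev 15 (statement re-type p126922: the dock's conclusion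
became `_root_.HydrodynamicLimit` verbatim, so `closes` lost its seventh hypothesis `DiluteSelfConsistency`; Assembly
stmt-17601, six antecedents) broke the seven-name `intro`; rev 16 (stmt-AtomisticToContinuum-17869) restated `Assembly`
as the FIVE-antecedent frame `KickFairRelEquilibriumMeso → SpectralContractionR → PercolationClosesChaos →
CollisionRate → LocalSecondLaw → HydrodynamicLimit`, i.e. the `closes` chain MINUS the dock `ChaosClosesEuler` — an
open statement (equivalent to `KickFairRelEquilibriumMeso → SpectralContractionR → ChaosClosesEuler`,
`Theorems.informationPercolationEngine_assembly_iff_dock` of `InformationPercolationEngineAssemblyReduction.lean`),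
NOT provable by bookkeeping. So, unlike the same-name repairs of `ThermalWedgeAssembly.lean` /
`EIHFluxBalanceAssembly.lean` (where the restated `Assembly` stayed one line from `closes`), the theorem cannot be
re-proved against the live `Assembly`; and Theorems files are append-only (a recorded declaration is neither restated
nor removed). Hence the repair DEPRECATES instead of mutating: the chain the theorem actually proved and was last
credited for is written out arrow for arrow, so that it no longer drifts with the route decl, as
`informationPercolationEngine_assembly_rev12_chain` — the ledger signature of stmt-AtomisticToContinuum-15179 verbatim
(that of stmt-15140 differs only in the name of crux 2, `KickFairRelEquilibrium`, retired at rev 12 and no longer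
declared by the route file), proved by the live six-hypothesis `closes` with the now idle seventh antecedent
`DiluteSelfConsistency` discarded — and the old name `informationPercolationEngine_assembly_rev8_proof` (the closing
decl of record of stmt-15140 / stmt-15179) is kept as a `@[deprecated]` alias of it. Neither is a proof of the live
item stmt-17869, and neither serves a `_holds` link.
-/

namespace Summit.AtomisticToContinuum.HydrodynamicLimit.Theorems

open Summit.AtomisticToContinuum.HydrodynamicLimit.Theses in
/-- **Assembly chain of route `InformationPercolationEngine`, revs 8/9 and 12** (stmt-AtomisticToContinuum-15140 /
stmt-AtomisticToContinuum-15179): the seven cruxes `KickFairRelEquilibriumMeso` (rev 8/9: `KickFairRelEquilibrium`),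
`SpectralContractionR`, `PercolationClosesChaos`, `CollisionRate`, `LocalSecondLaw`, `ChaosClosesEuler`,
`DiluteSelfConsistency` imply the sub-problem statement `_root_.HydrodynamicLimit` — the ledger signature of stmt-15179
verbatim, written out arrow for arrow (instead of being read through the route decl `Assembly`, restated under the same
name at revs 15/16 as a shorter, open frame — see the module docstring). Proof: the route's deciding theorem
`InformationPercolationEngine.closes` on the first six hypotheses; since the statement re-type (rev 15) the dock
`ChaosClosesEuler` concludes the packing-guarded conjunct `_root_.HydrodynamicLimit` itself, so the guard-removal crux
`DiluteSelfConsistency` is idle and discarded. [folklore] -/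
theorem informationPercolationEngine_assembly_rev12_chain :
    InformationPercolationEngine.KickFairRelEquilibriumMeso → InformationPercolationEngine.SpectralContractionR →
      InformationPercolationEngine.PercolationClosesChaos → InformationPercolationEngine.CollisionRate →
        InformationPercolationEngine.LocalSecondLaw → InformationPercolationEngine.ChaosClosesEuler →
          InformationPercolationEngine.DiluteSelfConsistency → _root_.HydrodynamicLimit :=
  fun hK hS hP hR hL hC _hD => InformationPercolationEngine.closes hK hS hP hR hL hC

/-- **Deprecated record** of the closing theorem of stmt-AtomisticToContinuum-15140 / -15179 (formerly
`theorem informationPercolationEngine_assembly_rev8_proof : InformationPercolationEngine.Assembly`, @ 0c2bc2a375dc):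
its statement tracked the route decl `Assembly`, restated under the same name at rev 16 (stmt-17869) as an OPEN
five-antecedent frame, so the name is kept as an alias of the written-out seven-antecedent chain it actually proved
(`informationPercolationEngine_assembly_rev12_chain`). [folklore] -/
@[deprecated informationPercolationEngine_assembly_rev12_chain (since := "2026-08-17")]
alias informationPercolationEngine_assembly_rev8_proof := informationPercolationEngine_assembly_rev12_chain

end Summit.AtomisticToContinuum.HydrodynamicLimit.Theorems
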